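import Mathlib
import HarnessLib
import Summits.HubbardSuperconductivity.HubbardSuperconductivity.Theorems.KLProgrammeKLRegimeEngineV8E5CarrierSplit
import Summits.HubbardSuperconductivity.HubbardSuperconductivity.Theorems.KLProgrammeKLRegimeEngineV8E5CarrierBlockStep
import Summits.HubbardSuperconductivity.HubbardSuperconductivity.Theorems.KLProgrammeKLRegimeEngineV8E5BlockTrivial

/-!
# Route `KLProgramme` — ENGINE child gen 8 (stmt-HubbardSuperconductivity-20437 `KLRegimeEngineV17F2`), SKELETON v2 class #3, (RA-U)/(RA-U)₀ SUPPLIER part 3b-ii: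
# the three one-step doors at the (R1′) objects with the TRIVIAL INPUT PAIR — the first steps (`n ≤ 2`, (RA-U)₀) and the small steps of (RA-U)
# (`n = 3, 4` for the first-order terms, `n ≤ 4`/`5` for the increment) whose aniso input level `n−3` / `n−4` would be `< 1`
# (cell gate-hubbard-kl, seat p5 g11; companion of …E5CarrierDoors; memo RA-U-SUPPLY §5 «n = 3 … trivial input family (E1's block-0 device)»)

With the trivial one-sector input pair `(trivialMultiplier, trivialMultiplier)` every plateau hypothesis of the generic prescribed doors
(`Literature/…/SectorisedIncrementBound{Graded,Binomial}PrescribedPlateau`) is automatic (`Σ_ω 1 = 1`: `sum_trivialMultiplier`, `trivialMultiplier_mul_self`,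
`trivialMultiplier_eq_zero_of_sum_eq_zero`, …E5BlockTrivial), the output family `F′` is ARBITRARY (a point-augmented aniso family of any level, or the trivial
family itself), the parents count is `1` (`card_parentsLeg_trivial_le_one`), and the Gram datum of the carrier's three covariances is the sectorless one of
…E5LinesTrivialGram §15 (`gram_softShaped_trivial_le` at `Λ′ = Λ_{n−1} ≤ 1/32`, `A_p = 10 / 2 / 8`: `κ² = 9152·A_p·Λ_{n−1}`), under ANY admissible frame
`FrameOK R U N μ K`, `klBetaMin ≤ β`, `β² ≤ L` — no k3c2-p2 binders:

* §1 `card_parentsLeg_trivial_le_one`;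
* §2 **`carrier_smearTotal_firstOrder_trivial_le`** (term 2), §3 **`carrier_increment_ordersGe2_trivial_le`** (term 3; rows `α` of the dressed partial slice
  through `trivialMultiplier` = the (b)₀ datum, raw text as in `h12r`'s (L1)₀), §4 **`carrier_smearSoft_firstOrder_trivial_le`** (term 4) — conclusions VERBATIM the
  generic doors' with `ρc = 1`, Gram constants `√(9152·A_p·Λ_{n−1})`.
REMAINING inputs as in …E5CarrierDoors: the prescribed sizes `B` through the trivial family (input (a)₀ / the increment's), the overlap rows `(cr, cc)` of
`E(F′)·S(1)`, the kit parameters, `Z ≠ 0`.  Pure composition of landed theorems; no definitions, no named facts; nothing asserts superconductivity.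
-/

noncomputable section

namespace Summit.HubbardSuperconductivity.HubbardSuperconductivity.Theorems.KLRegimeSplit

set_option linter.dupNamespace false -- summit = problem name (single-conjunct summit), D-0017

open Real Finset Literature.MathematicalPhysics.QuantumLattice Literature.Probability.LatticeModels GrassmannAlgebra Matrix
open Literature.MathematicalPhysics.QuantumLattice.FermiRG
open Summit.HubbardSuperconductivity.HubbardSuperconductivity.Theorems.KLProgrammeLegKernels
open Summit.HubbardSuperconductivity.HubbardSuperconductivity.Theorems.KLRegimeWick
open Summit.HubbardSuperconductivity.HubbardSuperconductivity.Theorems.EngineV8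
open Summit.HubbardSuperconductivity.HubbardSuperconductivity.Theorems.TwoPointAssembly
open Summit.HubbardSuperconductivity.HubbardSuperconductivity.Theorems.TorusFourierL2
open Summit.HubbardSuperconductivity.HubbardSuperconductivity.Theorems.DispersionFlow

/-! ## §1 Parents count of the trivial input family -/

/-- **A fine leg label has at most ONE parent in the trivial family** (the single sector, same spin and charge), whatever the child relation. [folklore] -/
theorem card_parentsLeg_trivial_le_one {N' : ℕ} (child : Fin N' → Fin 1 → Prop) [DecidableRel child] (ℓ'' : SectorLeg N') :
    (((univ.filter fun ℓ' : SectorLeg 1 => child ℓ''.1.1 ℓ'.1.1 ∧ ℓ'.1.2 = ℓ''.1.2 ∧ ℓ'.2 = ℓ''.2).card : ℝ)) ≤ 1 := by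
  have h : (univ.filter fun ℓ' : SectorLeg 1 => child ℓ''.1.1 ℓ'.1.1 ∧ ℓ'.1.2 = ℓ''.1.2 ∧ ℓ'.2 = ℓ''.2) ⊆
      {(((0 : Fin 1), ℓ''.1.2), ℓ''.2)} := by
    intro ℓ' hℓ'
    rw [mem_filter] at hℓ'
    rw [mem_singleton]
    obtain ⟨⟨a, b⟩, c⟩ := ℓ'
    obtain ⟨-, hb, hc⟩ := hℓ'.2
    simp only at hb hc
    rw [Subsingleton.elim a 0, hb, hc]
  have h1 := (card_le_card h).trans (card_singleton _).le
  exact_mod_cast h1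

section Doors

variable {L M : ℕ} [NeZero L] [NeZero M] {R : RenConsts} {U : ℝ} {N : ℕ} {μ : ℝ} {K : TrigPolyC4v} {β : ℝ}

/-! ## §2 Term 2 with the trivial input pair -/

/-- **TERM 2, TRIVIAL INPUT — `e^{Δ_{C∞}}V − V` through the binomial prescribed door**, input pair `(1, 1)`, output family `F′` arbitrary, Gram constant
`√(9152·10·Λ_{n−1})` (`1 ≤ n`; any admissible frame `K`, `klBetaMin ≤ β`, `β² ≤ L`; dressing smallness at `Λ_n` and `Λ`).  Remaining hypotheses: the
prescribed sizes `B` of `V` through the trivial family and the overlap rows `(cr, cc)` of `E(F′)·S(1)`. [cite: BenfattoGiulianiMastropietro2006, §2.8 (2.80)] -/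
theorem carrier_smearTotal_firstOrder_trivial_le (hK : FrameOK R U N μ K) (hβ : klBetaMin ≤ β) (hL : β ^ 2 ≤ (L : ℝ)) {n : ℕ} (hn : 1 ≤ n)
    {Λ : ℝ} (hΛ : Λ ∈ Set.Icc (klScale klE0 n) (klScale klE0 (n - 1)))
    (hsm : (∀ ks : FreqMomentum L M × Fin 2,
          ‖klE5SliceSym L M β μ K (n - 1) (klScale klE0 n) ks * klE5Kappa L M β U μ K (n - 1) ks‖ ≤ 1 / 2 ∧
          ‖klE5SliceSym L M β μ K (n - 1) Λ ks * klE5Kappa L M β U μ K (n - 1) ks‖ ≤ 1 / 2))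
    {N' : ℕ} (F' : Fin N' → FreqMomentum L M → ℂ) (B : ℕ → ℕ → ℝ) (hB0 : ∀ m' Fc, 0 ≤ B m' Fc)
    (hB : (∀ (m' Fc : ℕ) (E : Finset (Fin (2 * m' + 1 + 1))) (τ : Fin (2 * m' + 1 + 1) → SectorLeg 1)
          (q : Fin (2 * m' + 1 + 1)), q ∈ E → E.card = Fc + 1 → ∀ ys : SpaceTimeIdx L M,
            imagTimeWeight β M ^ (2 * m' + 1) *
              ∑ σ ∈ univ.filter (fun σ : Fin (2 * m' + 1 + 1) → SectorLeg 1 => ∀ e ∈ E, σ e = τ e),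
                ∑ xs ∈ univ.filter (fun xs : Fin (2 * m' + 1 + 1) → SpaceTimeIdx L M => xs q = ys),
                  ‖sectorisedKernel L M β (trivialMultiplier L M)
                    (klE5Input L M β U μ K (n - 1)) (2 * m' + 1 + 1) σ xs‖ ≤ B (m' + 1) Fc))
    {cr cc : ℝ} (hcc0 : 0 ≤ cc)
    (hrow' : ∀ X'', ∑ X', ‖(sectorAnalysisMatrix L M β F' * sectorSubMatrix L M β (trivialMultiplier L M)) X'' X'‖ ≤ cr)
    (hcol' : ∀ X', ∑ X'', ‖(sectorAnalysisMatrix L M β F' * sectorSubMatrix L M β (trivialMultiplier L M)) X'' X'‖ ≤ cc) :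
    ∀ {q : ℕ} (i : Fin (2 * q + 1 + 1)) (J : Finset (Fin (2 * q + 1 + 1))), i ∉ J →
      ∀ (τ'' : Fin (2 * q + 1 + 1) → SectorLeg N') (w'' : SpaceTimeIdx L M × SectorLeg N'),
      ∑ X'' ∈ univ.filter (fun X'' : Fin (2 * q + 1 + 1) → SpaceTimeIdx L M × SectorLeg N' => X'' i = w'' ∧ ∀ j ∈ J, (X'' j).2 = τ'' j),
        ‖kernel ℂ (ExteriorAlgebra.map (Matrix.toLin' (sectorAnalysisMatrix L M β F'))
          (gaussConv ℂ (klE5Total L M β μ K (n - 1) (klE5Kappa L M β U μ K (n - 1)))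
              (klE5Input L M β U μ K (n - 1)) -
            (klE5Input L M β U μ K (n - 1)))) (2 * q + 1 + 1) X''‖ ≤
      cr * cc ^ (2 * q + 1) *
        ∑ m' ∈ range (Fintype.card (SpaceTimeIdx L M × SectorLeg 1) / 2 + 1), (if q + 1 < m' then
          ((((2 * (q + 1)).factorial : ℝ))⁻¹ * ((∏ j ∈ univ.filter (fun j : Fin (2 * (q + 1)) => j ∉ J), (2 * m' - (j : ℕ)) : ℕ) : ℝ)) *
            ((2 * m' : ℕ) : ℝ) ^ J.card * Real.sqrt (9152 * 10 * klScale klE0 (n - 1)) ^ (2 * m' - 2 * (q + 1)) *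
              ((1 : ℝ) ^ J.card * (imagTimeWeight β M * B m' J.card)) else 0) := by
  classical
  have he₀ : (0 : ℝ) ≤ klE0 := by norm_num [klE0]
  have hβ0 : 0 < β := lt_of_lt_of_le (by norm_num [klBetaMin]) hβ
  have hn1 : n - 1 + 1 = n := by omega
  have hΛpos : 0 < Λ := lt_of_lt_of_le (klth_klScale_pos n) hΛ.1
  have hΛ'pos : 0 < klScale klE0 (n - 1) := klth_klScale_pos _
  have hΛ'32 : klScale klE0 (n - 1) ≤ 1 / 32 := (klScale_le_klScale he₀ (Nat.zero_le _)).trans (by norm_num [klScale, klE0])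
  intro q i J hi τ'' w''
  set κ := klE5Kappa L M β U μ K (n - 1) with hκ
  set p : FreqMomentum L M × Fin 2 → ℂ := fun ks => klE5SoftLineSym L M β μ K (n - 1) κ Λ ks +
      klE5SliceSym L M β μ K (n - 1) Λ ks / (1 + klE5SliceSym L M β μ K (n - 1) Λ ks * κ ks) with hp
  have hshape : ∀ ks, p ks ≠ 0 → ‖p ks‖ ≤ 10 * (β * (L : ℝ) ^ 2) / Real.sqrt (matsubaraFreq β M ks.1.1 ^ 2 + nambuXiCT L μ K ks.1.2 ^ 2) := by
    intro ks _
    have h1 : ‖klE5SliceSym L M β μ K (n - 1) (klScale klE0 (n - 1 + 1)) ks * κ ks‖ ≤ 1 / 2 := by rw [hn1]; exact (hsm ks).1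
    exact norm_klE5TotalSym_le_div_radius β μ K (n - 1) κ hβ0.le ks h1 (hsm ks).2
  have hsupp : ∀ ks, p ks ≠ 0 → Real.sqrt (matsubaraFreq β M ks.1.1 ^ 2 + nambuXiCT L μ K ks.1.2 ^ 2) ≤ klScale klE0 (n - 1) :=
    fun ks hks => klRadius_le_of_klE5TotalSym_ne_zero β μ K (n - 1) κ hΛpos hΛ.2 ks hks
  obtain ⟨-, hF, hG⟩ := gram_softShaped_trivial_le (L := L) (M := M) hK hβ hL hΛ'pos hΛ'32 p (by norm_num : (0 : ℝ) ≤ 10) hshape hsupp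
  have hGB := isGramBoundedR_of_halfNorm_le β (trivialMultiplier L M) p (Real.sqrt_nonneg _) hF hG
  have hC : klE5Total L M β μ K (n - 1) κ = normalCovariance L M p := klE5Total_eq_normalCovariance β μ K (n - 1) κ Λ
  have hV : klE5Input L M β U μ K (n - 1) ∈ evenPart ℂ (HubbardFieldIdx L M) := klE5Input_mem_evenPart β U μ K (n - 1) hβ0.ne'
  rw [hC]
  exact sum_filter_norm_sectorAnalysis_gaussConv_sub_le_binomial_prescribed_of_plateau hβ0 (trivialMultiplier L M) (trivialMultiplier L M)
    trivialMultiplier_mul_self trivialMultiplier_eq_zero_of_sum_eq_zero F' (klE5Input L M β U μ K (n - 1)) hV (normalCovariance L M p)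
    (fun X Y _ => ⟨sum_trivialMultiplier _, sum_trivialMultiplier _⟩) (fun _ k _ => sum_trivialMultiplier k)
    (fun ω'' ω' => ∃ k : FreqMomentum L M, F' ω'' k ≠ 0 ∧ trivialMultiplier L M ω' k ≠ 0)
    (fun X'' X' hne => overlap_of_sectorAnalysis_mul_sectorSub_ne_zero β _ _ X'' X' hne)
    (ρc := 1) (by norm_num) (fun ℓ'' => card_parentsLeg_trivial_le_one (fun ω'' ω' => ∃ k : FreqMomentum L M, F' ω'' k ≠ 0 ∧ trivialMultiplier L M ω' k ≠ 0) ℓ'')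
    (κ := Real.sqrt (9152 * 10 * klScale klE0 (n - 1))) (Real.sqrt_nonneg _) hGB B hB0 hB hcc0 hrow' hcol' i J hi τ'' w''

/-! ## §3 Term 3 with the trivial input pair -/

/-- **TERM 3, TRIVIAL INPUT — `I_Λ = effAction C_Λ V − e^{Δ_{C_Λ}}V` through the graded prescribed door**, input pair `(1, 1)`, output family `F′` arbitrary,
Gram constant `√(9152·2·Λ_{n−1})`; rows/columns `α > 0` of the dressed partial slice THROUGH THE TRIVIAL FAMILY (the (b)₀ datum, raw text); `V` even and
constant-free (`Z^K_{Λ_{n−1}} ≠ 0`).  Remaining hypotheses: `B` (input (a)₀), `ρ`, `θ < 1`, `N₀`, `(cr, cc)`. [cite: BenfattoGiulianiMastropietro2006, §2.8 (2.82)-(2.84)] -/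
theorem carrier_increment_ordersGe2_trivial_le (hK : FrameOK R U N μ K) (hβ : klBetaMin ≤ β) (hL : β ^ 2 ≤ (L : ℝ)) {n : ℕ} (hn : 1 ≤ n)
    (hZ : hubbardEffPartitionFnCT L M β U μ 0 K (klScale klE0 (n - 1)) ≠ 0)
    {Λ : ℝ} (hΛ : Λ ∈ Set.Icc (klScale klE0 n) (klScale klE0 (n - 1)))
    (hsm : (∀ ks : FreqMomentum L M × Fin 2, ‖klE5SliceSym L M β μ K (n - 1) Λ ks * klE5Kappa L M β U μ K (n - 1) ks‖ ≤ 1 / 2))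
    {N' : ℕ} (F' : Fin N' → FreqMomentum L M → ℂ)
    {α : ℝ} (hα : 0 < α)
    (hrow : ∀ X, ∑ Y, ‖((sectorSubMatrix L M β (trivialMultiplier L M)).transpose * (klE5DressedSlice L M β μ K (n - 1) (klE5Kappa L M β U μ K (n - 1)) Λ) *
        sectorSubMatrix L M β (trivialMultiplier L M)) X Y‖ ≤ α)
    (hcol : ∀ Y, ∑ X, ‖((sectorSubMatrix L M β (trivialMultiplier L M)).transpose * (klE5DressedSlice L M β μ K (n - 1) (klE5Kappa L M β U μ K (n - 1)) Λ) *
        sectorSubMatrix L M β (trivialMultiplier L M)) X Y‖ ≤ α)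
    (B : ℕ → ℕ → ℝ) (hB0 : ∀ m' Fc, 0 ≤ B m' Fc)
    (hB : (∀ (m' Fc : ℕ) (E : Finset (Fin (2 * m' + 1 + 1))) (τ : Fin (2 * m' + 1 + 1) → SectorLeg 1)
          (q : Fin (2 * m' + 1 + 1)), q ∈ E → E.card = Fc + 1 → ∀ ys : SpaceTimeIdx L M,
            imagTimeWeight β M ^ (2 * m' + 1) *
              ∑ σ ∈ univ.filter (fun σ : Fin (2 * m' + 1 + 1) → SectorLeg 1 => ∀ e ∈ E, σ e = τ e),
                ∑ xs ∈ univ.filter (fun xs : Fin (2 * m' + 1 + 1) → SpaceTimeIdx L M => xs q = ys),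
                  ‖sectorisedKernel L M β (trivialMultiplier L M)
                    (klE5Input L M β U μ K (n - 1)) (2 * m' + 1 + 1) σ xs‖ ≤ B (m' + 1) Fc))
    {ρ : ℝ} (hρ : 0 < ρ)
    (hθ : Real.exp 1 * α * normV (SpaceTimeIdx L M × SectorLeg 1) (Real.sqrt (9152 * 2 * klScale klE0 (n - 1))) ρ
              (fun m' => (1 : ℝ) ^ 0 * (imagTimeWeight β M * B m' 0)) / Real.sqrt (9152 * 2 * klScale klE0 (n - 1)) ^ 2 < 1)
    {cr cc : ℝ} (hcc0 : 0 ≤ cc)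
    (hrow' : ∀ X'', ∑ X', ‖(sectorAnalysisMatrix L M β F' * sectorSubMatrix L M β (trivialMultiplier L M)) X'' X'‖ ≤ cr)
    (hcol' : ∀ X', ∑ X'', ‖(sectorAnalysisMatrix L M β F' * sectorSubMatrix L M β (trivialMultiplier L M)) X'' X'‖ ≤ cc) :
    ∀ {N₀ : ℕ}, 2 ≤ N₀ → ∀ {m : ℕ} (p_1 : Fin (m + 1)) (J : Finset (Fin (m + 1))), p_1 ∉ J →
      ∀ (τ'' : Fin (m + 1) → SectorLeg N') (w'' : SpaceTimeIdx L M × SectorLeg N'),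
      ∑ X'' ∈ univ.filter (fun X'' : Fin (m + 1) → SpaceTimeIdx L M × SectorLeg N' => X'' p_1 = w'' ∧ ∀ j ∈ J, (X'' j).2 = τ'' j),
        ‖kernel ℂ (ExteriorAlgebra.map (Matrix.toLin' (sectorAnalysisMatrix L M β F'))
          (effAction ℂ (klE5DressedSlice L M β μ K (n - 1) (klE5Kappa L M β U μ K (n - 1)) Λ) (klE5Input L M β U μ K (n - 1)) -
            gaussConv ℂ (klE5DressedSlice L M β μ K (n - 1) (klE5Kappa L M β U μ K (n - 1)) Λ) (klE5Input L M β U μ K (n - 1)))) (m + 1) X''‖ ≤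
      cr * cc ^ m *
        (∑ n' ∈ Ico 2 N₀, ((Real.sqrt (9152 * 2 * klScale klE0 (n - 1)))⁻¹ ^ (m + 1) * (Real.sqrt (9152 * 2 * klScale klE0 (n - 1)))⁻¹ ^ (2 * (n' - 1)) * (α ^ (n' - 1) * Real.exp n')) *
            ∑ δ ∈ (Fintype.piFinset fun _ : Fin n' => range (Fintype.card (SpaceTimeIdx L M × SectorLeg 1) / 2 + 1)) with
                m + 1 + 2 * (n' - 1) ≤ ∑ a, 2 * δ a,
              ∑ pf : J → Fin n', ((∏ j, ((2 * δ (pf j) : ℕ) : ℝ)) / ((∑ a, 2 * δ a : ℕ) : ℝ) ^ J.card) *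
                ∏ a, (Real.exp 3 * Real.sqrt (9152 * 2 * klScale klE0 (n - 1))) ^ (2 * δ a) *
                  ((1 : ℝ) ^ (univ.filter fun j : J => pf j = a).card *
                    (imagTimeWeight β M * B (δ a) (univ.filter fun j : J => pf j = a).card)) +
          ρ⁻¹ ^ (m + 1) * (Real.exp 1 * normV (SpaceTimeIdx L M × SectorLeg 1) (Real.sqrt (9152 * 2 * klScale klE0 (n - 1))) ρ
              (fun m' => (1 : ℝ) ^ 0 * (imagTimeWeight β M * B m' 0))) *
            (Real.exp 1 * α * normV (SpaceTimeIdx L M × SectorLeg 1) (Real.sqrt (9152 * 2 * klScale klE0 (n - 1))) ρ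
              (fun m' => (1 : ℝ) ^ 0 * (imagTimeWeight β M * B m' 0)) / Real.sqrt (9152 * 2 * klScale klE0 (n - 1)) ^ 2) ^ (N₀ - 1) /
            (1 - Real.exp 1 * α * normV (SpaceTimeIdx L M × SectorLeg 1) (Real.sqrt (9152 * 2 * klScale klE0 (n - 1))) ρ
              (fun m' => (1 : ℝ) ^ 0 * (imagTimeWeight β M * B m' 0)) / Real.sqrt (9152 * 2 * klScale klE0 (n - 1)) ^ 2)) := by
  classical
  have he₀ : (0 : ℝ) ≤ klE0 := by norm_num [klE0]
  have hβ0 : 0 < β := lt_of_lt_of_le (by norm_num [klBetaMin]) hβ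
  have hn1 : n - 1 + 1 = n := by omega
  have hΛpos : 0 < Λ := lt_of_lt_of_le (klth_klScale_pos n) hΛ.1
  have hΛ'pos : 0 < klScale klE0 (n - 1) := klth_klScale_pos _
  have hΛ'32 : klScale klE0 (n - 1) ≤ 1 / 32 := (klScale_le_klScale he₀ (Nat.zero_le _)).trans (by norm_num [klScale, klE0])
  intro N₀ hN₀ m p_1 J hp_1 τ'' w''
  set κ := klE5Kappa L M β U μ K (n - 1) with hκ
  set V := klE5Input L M β U μ K (n - 1) with hV
  set p : FreqMomentum L M × Fin 2 → ℂ := fun ks => klE5SliceSym L M β μ K (n - 1) Λ ks / (1 + klE5SliceSym L M β μ K (n - 1) Λ ks * κ ks) with hp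
  have hshape : ∀ ks, p ks ≠ 0 → ‖p ks‖ ≤ 2 * (β * (L : ℝ) ^ 2) / Real.sqrt (matsubaraFreq β M ks.1.1 ^ 2 + nambuXiCT L μ K ks.1.2 ^ 2) :=
    fun ks _ => norm_klE5DressedSliceSym_le_div_radius β μ K (n - 1) κ hβ0.le ks (hsm ks)
  have hsupp : ∀ ks, p ks ≠ 0 → Real.sqrt (matsubaraFreq β M ks.1.1 ^ 2 + nambuXiCT L μ K ks.1.2 ^ 2) ≤ klScale klE0 (n - 1) :=
    fun ks hks => klRadius_le_of_klE5DressedSliceSym_ne_zero β μ K (n - 1) κ hΛpos hΛ.2 ks hks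
  obtain ⟨-, hF, hG⟩ := gram_softShaped_trivial_le (L := L) (M := M) hK hβ hL hΛ'pos hΛ'32 p (by norm_num : (0 : ℝ) ≤ 2) hshape hsupp
  have hGB := isGramBoundedR_of_halfNorm_le β (trivialMultiplier L M) p (Real.sqrt_nonneg _) hF hG
  have hC : klE5DressedSlice L M β μ K (n - 1) κ Λ = normalCovariance L M p := rfl
  have hVe : V ∈ evenPart ℂ (HubbardFieldIdx L M) := klE5Input_mem_evenPart β U μ K (n - 1) hβ0.ne'
  have hV0 : constPart ℂ V = 0 := constPart_klE5Input_eq_zero β U μ K (n - 1) hZ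
  have hκpos : 0 < Real.sqrt (9152 * 2 * klScale klE0 (n - 1)) :=
    Real.sqrt_pos.2 (by have : (0 : ℝ) < klScale klE0 (n - 1) := hΛ'pos
                        positivity)
  rw [hC] at hrow hcol ⊢
  exact sum_filter_norm_sectorAnalysis_effAction_sub_gaussConv_le_graded_prescribed_of_plateau hβ0 (trivialMultiplier L M) (trivialMultiplier L M)
    trivialMultiplier_mul_self trivialMultiplier_eq_zero_of_sum_eq_zero F' V hVe hV0 (normalCovariance L M p)
    (fun X Y _ => ⟨sum_trivialMultiplier _, sum_trivialMultiplier _⟩) (fun _ k _ => sum_trivialMultiplier k)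
    (fun ω'' ω' => ∃ k : FreqMomentum L M, F' ω'' k ≠ 0 ∧ trivialMultiplier L M ω' k ≠ 0)
    (fun X'' X' hne => overlap_of_sectorAnalysis_mul_sectorSub_ne_zero β _ _ X'' X' hne)
    (ρc := 1) (by norm_num) (fun ℓ'' => card_parentsLeg_trivial_le_one (fun ω'' ω' => ∃ k : FreqMomentum L M, F' ω'' k ≠ 0 ∧ trivialMultiplier L M ω' k ≠ 0) ℓ'')
    (κ := Real.sqrt (9152 * 2 * klScale klE0 (n - 1))) hκpos hGB B hB0 hB hα hrow hcol hρ hθ hcc0 hrow' hcol' hN₀ p_1 J hp_1 τ'' w''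

/-! ## §4 Term 4 with the trivial input pair -/

/-- **TERM 4, TRIVIAL INPUT — `e^{Δ_D}I_Λ − I_Λ` through the binomial prescribed door** (`D = C∞ − C_Λ = normalCovariance (klE5SoftLineSym … Λ)`,
`A_p = 8`), input pair `(1, 1)`, output family `F′` arbitrary, Gram constant `√(9152·8·Λ_{n−1})`; `I_Λ` even (`Z^K_{Λ_{n−1}} ≠ 0`).  Remaining hypotheses:
the prescribed sizes `B` of `I_Λ` through the trivial family (= §3 at `F′ = 1`) and `(cr, cc)`. [cite: BenfattoGiulianiMastropietro2006, §2.8 (2.80)] -/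
theorem carrier_smearSoft_firstOrder_trivial_le (hK : FrameOK R U N μ K) (hβ : klBetaMin ≤ β) (hL : β ^ 2 ≤ (L : ℝ)) {n : ℕ} (hn : 1 ≤ n)
    (hZ : hubbardEffPartitionFnCT L M β U μ 0 K (klScale klE0 (n - 1)) ≠ 0)
    {Λ : ℝ} (hΛ : Λ ∈ Set.Icc (klScale klE0 n) (klScale klE0 (n - 1)))
    (hsm : (∀ ks : FreqMomentum L M × Fin 2,
          ‖klE5SliceSym L M β μ K (n - 1) (klScale klE0 n) ks * klE5Kappa L M β U μ K (n - 1) ks‖ ≤ 1 / 2 ∧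
          ‖klE5SliceSym L M β μ K (n - 1) Λ ks * klE5Kappa L M β U μ K (n - 1) ks‖ ≤ 1 / 2))
    {N' : ℕ} (F' : Fin N' → FreqMomentum L M → ℂ) (B : ℕ → ℕ → ℝ) (hB0 : ∀ m' Fc, 0 ≤ B m' Fc)
    (hB : (∀ (m' Fc : ℕ) (E : Finset (Fin (2 * m' + 1 + 1))) (τ : Fin (2 * m' + 1 + 1) → SectorLeg 1)
          (q : Fin (2 * m' + 1 + 1)), q ∈ E → E.card = Fc + 1 → ∀ ys : SpaceTimeIdx L M,
            imagTimeWeight β M ^ (2 * m' + 1) *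
              ∑ σ ∈ univ.filter (fun σ : Fin (2 * m' + 1 + 1) → SectorLeg 1 => ∀ e ∈ E, σ e = τ e),
                ∑ xs ∈ univ.filter (fun xs : Fin (2 * m' + 1 + 1) → SpaceTimeIdx L M => xs q = ys),
                  ‖sectorisedKernel L M β (trivialMultiplier L M)
                    (effAction ℂ (klE5DressedSlice L M β μ K (n - 1) (klE5Kappa L M β U μ K (n - 1)) Λ)
                        (klE5Input L M β U μ K (n - 1)) -
                      gaussConv ℂ (klE5DressedSlice L M β μ K (n - 1) (klE5Kappa L M β U μ K (n - 1)) Λ)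
                        (klE5Input L M β U μ K (n - 1))) (2 * m' + 1 + 1) σ xs‖ ≤ B (m' + 1) Fc))
    {cr cc : ℝ} (hcc0 : 0 ≤ cc)
    (hrow' : ∀ X'', ∑ X', ‖(sectorAnalysisMatrix L M β F' * sectorSubMatrix L M β (trivialMultiplier L M)) X'' X'‖ ≤ cr)
    (hcol' : ∀ X', ∑ X'', ‖(sectorAnalysisMatrix L M β F' * sectorSubMatrix L M β (trivialMultiplier L M)) X'' X'‖ ≤ cc) :
    ∀ {q : ℕ} (i : Fin (2 * q + 1 + 1)) (J : Finset (Fin (2 * q + 1 + 1))), i ∉ J →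
      ∀ (τ'' : Fin (2 * q + 1 + 1) → SectorLeg N') (w'' : SpaceTimeIdx L M × SectorLeg N'),
      ∑ X'' ∈ univ.filter (fun X'' : Fin (2 * q + 1 + 1) → SpaceTimeIdx L M × SectorLeg N' => X'' i = w'' ∧ ∀ j ∈ J, (X'' j).2 = τ'' j),
        ‖kernel ℂ (ExteriorAlgebra.map (Matrix.toLin' (sectorAnalysisMatrix L M β F'))
          (gaussConv ℂ (klE5Total L M β μ K (n - 1) (klE5Kappa L M β U μ K (n - 1)) -
                klE5DressedSlice L M β μ K (n - 1) (klE5Kappa L M β U μ K (n - 1)) Λ)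
              (effAction ℂ (klE5DressedSlice L M β μ K (n - 1) (klE5Kappa L M β U μ K (n - 1)) Λ) (klE5Input L M β U μ K (n - 1)) -
            gaussConv ℂ (klE5DressedSlice L M β μ K (n - 1) (klE5Kappa L M β U μ K (n - 1)) Λ) (klE5Input L M β U μ K (n - 1))) -
            (effAction ℂ (klE5DressedSlice L M β μ K (n - 1) (klE5Kappa L M β U μ K (n - 1)) Λ) (klE5Input L M β U μ K (n - 1)) -
            gaussConv ℂ (klE5DressedSlice L M β μ K (n - 1) (klE5Kappa L M β U μ K (n - 1)) Λ) (klE5Input L M β U μ K (n - 1))))) (2 * q + 1 + 1) X''‖ ≤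
      cr * cc ^ (2 * q + 1) *
        ∑ m' ∈ range (Fintype.card (SpaceTimeIdx L M × SectorLeg 1) / 2 + 1), (if q + 1 < m' then
          ((((2 * (q + 1)).factorial : ℝ))⁻¹ * ((∏ j ∈ univ.filter (fun j : Fin (2 * (q + 1)) => j ∉ J), (2 * m' - (j : ℕ)) : ℕ) : ℝ)) *
            ((2 * m' : ℕ) : ℝ) ^ J.card * Real.sqrt (9152 * 8 * klScale klE0 (n - 1)) ^ (2 * m' - 2 * (q + 1)) *
              ((1 : ℝ) ^ J.card * (imagTimeWeight β M * B m' J.card)) else 0) := by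
  classical
  have he₀ : (0 : ℝ) ≤ klE0 := by norm_num [klE0]
  have hβ0 : 0 < β := lt_of_lt_of_le (by norm_num [klBetaMin]) hβ
  have hn1 : n - 1 + 1 = n := by omega
  have hΛpos : 0 < Λ := lt_of_lt_of_le (klth_klScale_pos n) hΛ.1
  have hΛ'pos : 0 < klScale klE0 (n - 1) := klth_klScale_pos _
  have hΛ'32 : klScale klE0 (n - 1) ≤ 1 / 32 := (klScale_le_klScale he₀ (Nat.zero_le _)).trans (by norm_num [klScale, klE0])
  intro q i J hi τ'' w''
  set κ := klE5Kappa L M β U μ K (n - 1) with hκ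
  set V := klE5Input L M β U μ K (n - 1) with hV
  set p : FreqMomentum L M × Fin 2 → ℂ := klE5SoftLineSym L M β μ K (n - 1) κ Λ with hp
  have hshape : ∀ ks, p ks ≠ 0 → ‖p ks‖ ≤ 8 * (β * (L : ℝ) ^ 2) / Real.sqrt (matsubaraFreq β M ks.1.1 ^ 2 + nambuXiCT L μ K ks.1.2 ^ 2) := by
    intro ks _
    have h1 : ‖klE5SliceSym L M β μ K (n - 1) (klScale klE0 (n - 1 + 1)) ks * κ ks‖ ≤ 1 / 2 := by rw [hn1]; exact (hsm ks).1
    exact norm_klE5SoftLineSym_le_div_radius β μ K (n - 1) κ hβ0.le ks h1 (hsm ks).2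
  have hsupp : ∀ ks, p ks ≠ 0 → Real.sqrt (matsubaraFreq β M ks.1.1 ^ 2 + nambuXiCT L μ K ks.1.2 ^ 2) ≤ klScale klE0 (n - 1) :=
    fun ks hks => klRadius_le_of_klE5SoftLineSym_ne_zero (L := L) (M := M) (β := β) κ μ K (n - 1) hΛpos hΛ.2 ks hks
  obtain ⟨-, hF, hG⟩ := gram_softShaped_trivial_le (L := L) (M := M) hK hβ hL hΛ'pos hΛ'32 p (by norm_num : (0 : ℝ) ≤ 8) hshape hsupp
  have hGB := isGramBoundedR_of_halfNorm_le β (trivialMultiplier L M) p (Real.sqrt_nonneg _) hF hG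
  have hD : klE5Total L M β μ K (n - 1) κ - klE5DressedSlice L M β μ K (n - 1) κ Λ = normalCovariance L M p :=
    klE5Total_sub_dressedSlice_eq_normalCovariance L M β μ K (n - 1) κ Λ
  have hVe : V ∈ evenPart ℂ (HubbardFieldIdx L M) := klE5Input_mem_evenPart β U μ K (n - 1) hβ0.ne'
  have hV0 : constPart ℂ V = 0 := constPart_klE5Input_eq_zero β U μ K (n - 1) hZ
  have hI : effAction ℂ (klE5DressedSlice L M β μ K (n - 1) κ Λ) V - gaussConv ℂ (klE5DressedSlice L M β μ K (n - 1) κ Λ) V ∈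
      evenPart ℂ (HubbardFieldIdx L M) :=
    sub_mem (effAction_mem_evenPart _ hVe hV0) (mem_evenPart_iff.2 (gaussConv_mem_evenOdd ℂ _ (mem_evenPart_iff.1 hVe)))
  rw [hD]
  exact sum_filter_norm_sectorAnalysis_gaussConv_sub_le_binomial_prescribed_of_plateau hβ0 (trivialMultiplier L M) (trivialMultiplier L M)
    trivialMultiplier_mul_self trivialMultiplier_eq_zero_of_sum_eq_zero F'
    (effAction ℂ (klE5DressedSlice L M β μ K (n - 1) κ Λ) V - gaussConv ℂ (klE5DressedSlice L M β μ K (n - 1) κ Λ) V) hI (normalCovariance L M p)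
    (fun X Y _ => ⟨sum_trivialMultiplier _, sum_trivialMultiplier _⟩) (fun _ k _ => sum_trivialMultiplier k)
    (fun ω'' ω' => ∃ k : FreqMomentum L M, F' ω'' k ≠ 0 ∧ trivialMultiplier L M ω' k ≠ 0)
    (fun X'' X' hne => overlap_of_sectorAnalysis_mul_sectorSub_ne_zero β _ _ X'' X' hne)
    (ρc := 1) (by norm_num) (fun ℓ'' => card_parentsLeg_trivial_le_one (fun ω'' ω' => ∃ k : FreqMomentum L M, F' ω'' k ≠ 0 ∧ trivialMultiplier L M ω' k ≠ 0) ℓ'')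
    (κ := Real.sqrt (9152 * 8 * klScale klE0 (n - 1))) (Real.sqrt_nonneg _) hGB B hB0 hB hcc0 hrow' hcol' i J hi τ'' w''

end Doors

end Summit.HubbardSuperconductivity.HubbardSuperconductivity.Theorems.KLRegimeSplit

end
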